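import Summits.ABC.ABC.Theses.IsogenyGlueCongruence
import Literature.NumberTheory.EllipticCurves.DegreeConjectureAbcMurty
import Literature.NumberTheory.EllipticCurves.DegreeConjectureAbcMurtyConverseProofs
import Literature.NumberTheory.EllipticCurves.PeterssonNormLowerBoundSqrtProofs
import Literature.NumberTheory.EllipticCurves.SzpiroOfAbcProofs
import Literature.Barriers.ABC.SzpiroEpsilonCannotBeDroppedHolds

/-!
# `PolyDegreeOfBoundedPrimes` (stmt-ABC-2046, crux B of route IsogenyGlueCongruence) — the
consequent admits no exponent below `3/2` (unconditionally) and none below `2` under the route's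
`PeterssonLowerBound`

Negative support (cdisprove seat `refuter-cdisprove-stmt-ABC-2046-0`, 2026-08-16). The consequent
of crux B is the polynomial modular-degree conjecture for SEMISTABLE curves in the tree's
`∃ D : ModularParametrizationData W N_W` idiom over globally minimal models. On the global minimal
models `freyIntModel₂ A B ⊗ ℚ` (Bombieri–Gubler (12.18)) of the Masser-type Frey pairs of
`exists_masser_frey_pair` (copied from `FreyDegreeBound.Disproof.exists_frey_pair_excess`; conductor `N → ∞`, `N⁶ ≤ |Δ_min|`, semistable,
conductor equal to that of the Frey model) every datum has `deg > C·N^θ` for `θ < 2 − η` as soon as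
`(f,f) ≫ N^{1−η}` (Frey–Murty run backwards: Zagier's identity, `c ≠ 0`, Silverman's covolume
inequality). With the tree's unconditional `(f,f) ≫_η N^{1−η}` for `η > 1/2`
(`HoffsteinLockhart1994_peterssonProduct_lower_bound_of_half_lt`) this excludes every `θ < 3/2`;
with the route item `PeterssonLowerBound` every `θ < 2`. So a proof of crux B must output an
exponent `κ' ≥ 3/2` (resp. `≥ 2`) whatever exponent crux A is granted with.

* `abs_Δ_le_of_minimal_datum`, `deg_gt_on_szpiro_six_minimal` — the pointwise mechanism;
* `not_polyDegreeExp_of_petersson`, `not_polyDegreeExp_of_lt_three_halves`,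
  `not_polyDegreeExp_of_lt_two` — the exclusions;
* `not_imp_polyDegreeExp_of_degreePrimes` — granted A, the fixed-exponent form of B fails for
  `θ < 3/2`.
-/

noncomputable section

-- `Summit.<Summit>.<Problem>`: for the single-conjunct summit `ABC` the duplicate `ABC.ABC` is mandated.
set_option linter.dupNamespace false

open scoped MatrixGroups
open IsDedekindDomain WeierstrassCurve NumberField
open Literature.NumberTheory.DiophantineGeometry Literature.NumberTheory.EllipticCurves
  UniqueFactorizationMonoid Literature.Barriers.ABC Literature.Barriers.ABC.Masser
open Literature.NumberTheory.EllipticCurves.ModularForms CongruenceSubgroup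
open Summit.ABC.ABC.Theses.IsogenyGlueCongruence

namespace Summit.ABC.ABC.Theorems.PolyDegreeOfBoundedPrimes.Negative

/-- **Masser-type Frey pairs with Szpiro ratio at least `6`, parameters exposed** (verbatim copy of
`Summit.ABC.ABC.Cruxes.FreyDegreeBound.Disproof.exists_frey_pair_excess`, cdisprove seat of
stmt-ABC-2019, 2026-08-16 — copied rather than imported so that this file depends on Literature
modules only). For every `N₀` there are coprime `A, B` with `AB(A+B) ≠ 0` in Serre's normalisation
`A ≡ −1 (mod 4)`, `32 ∣ B`, whose Frey curve has conductor `N > N₀`, `2⁸ N⁶ ≤ (AB(A+B))²`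
(i.e. `N⁶ ≤ |Δ_min|`) and an odd prime factor `q` of `N`; the family of `Masser.exists_curve` with
`t = 2` odd primes, `G = q` a prime `> max(15, N₀)`, `j = 3q + 6`. [folklore] -/
theorem exists_masser_frey_pair (N₀ : ℕ) :
    ∃ A B : ℤ, IsCoprime A B ∧ A * B * (A + B) ≠ 0 ∧ A ≡ -1 [ZMOD 4] ∧ (32 : ℤ) ∣ B ∧
      N₀ < (freyCurve A B).conductorNorm ℤ ∧
      2 ^ 8 * ((freyCurve A B).conductorNorm ℤ) ^ 6 ≤ (A * B * (A + B)).natAbs ^ 2 ∧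
      ∃ q : ℕ, q.Prime ∧ 2 < q ∧ q ∣ (freyCurve A B).conductorNorm ℤ := by
  set P : ℕ := ∏ i : Fin 2, Nat.nth Nat.Prime (i + 1) with hPdef
  have hP0 : 0 < P := prod_nth_prime_succ_pos 2
  have hP2 : ¬ 2 ∣ P := not_two_dvd_prod_nth_prime_succ 2
  have hP3 : 3 ≤ P := three_le_prod_nth_prime_succ (by norm_num)
  obtain ⟨q, hq_ge, hq⟩ := Nat.exists_infinite_primes (max P N₀ + 1)
  have hPq : P < q := by
    have := le_max_left P N₀
    omega
  have hN0q : N₀ < q := by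
    have := le_max_right P N₀
    omega
  have hG : q < 2 ^ q := Nat.lt_two_pow_self
  have hPG : P < 2 ^ q := hPq.trans hG
  set j : ℕ := 3 * q + 6 with hj
  set M : ℕ := 2 ^ j with hM
  set k : ℕ := q + 5 with hk
  have hkG : k + (2 * q + 1) = j := by omega
  set m : ℕ := 2 ^ k * q with hmdef
  have hqP : ¬ q ∣ P := fun h => absurd (Nat.le_of_dvd hP0 h) (not_le.mpr hPq)
  have hm0 : 0 < m := Nat.mul_pos (pow_pos two_pos k) hq.pos
  have hmP : Nat.Coprime m P := by
    apply Nat.Coprime.mul_left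
    · exact Nat.Coprime.pow_left _ (Nat.prime_two.coprime_iff_not_dvd.mpr hP2)
    · exact (Nat.Prime.coprime_iff_not_dvd hq).mpr hqP
  -- the counting condition `m · (q · M) < M^2`
  have hcount : m * (q * M) < M ^ 2 := by
    have h1 : m * (q * M) < 2 ^ k * 2 ^ q * (2 ^ q * 2 ^ j) := by
      rw [hmdef, hM]
      calc 2 ^ k * q * (q * 2 ^ j) ≤ 2 ^ k * q * (2 ^ q * 2 ^ j) := by gcongr
        _ < 2 ^ k * 2 ^ q * (2 ^ q * 2 ^ j) := by gcongr
    have h2 : 2 ^ k * 2 ^ q * (2 ^ q * 2 ^ j) = 2 ^ (j * 2 - 1) := by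
      rw [← pow_add, ← pow_add, ← pow_add]
      congr 1
      omega
    have h3 : 2 ^ (j * 2 - 1) < M ^ 2 := by
      rw [hM, ← pow_mul]
      exact Nat.pow_lt_pow_right one_lt_two (by omega)
    omega
  obtain ⟨n, n', hn, hn', hlt, h2n, hmod, hn0⟩ := exists_close_pair 2 j q m hm0 hPG hcount
  obtain ⟨a, b, c, habc, haP, hcP, hmb, hc2a⟩ :=
    exists_triple_of_close_units hmP hn hn' hlt h2n hmod hn0
  have habc' := habc
  obtain ⟨ha0, hb0, hsum, hcop⟩ := habc'
  have h2kb : 2 ^ k ∣ b := dvd_trans (dvd_mul_right _ _) hmb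
  have hqb : q ∣ b := dvd_trans (dvd_mul_left _ _) hmb
  have h32b : 32 ∣ b := by
    have : (32 : ℕ) = 2 ^ 5 := by norm_num
    rw [this]
    exact dvd_trans (pow_dvd_pow 2 (by omega : 5 ≤ k)) h2kb
  have ha2 : ¬ 2 ∣ a := fun h => hP2 (Nat.prime_two.dvd_of_dvd_pow (dvd_trans h haP))
  have habc0 : a * b * c ≠ 0 := Nat.mul_ne_zero (Nat.mul_ne_zero ha0.ne' hb0.ne') (by omega)
  obtain ⟨A, B, hAB, h0, hA, hB, hprod⟩ := exists_frey_params habc ha2 h32b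
  -- Masser's Lemma 1: `N = rad(abc)`
  have hN : (freyCurve A B).conductorNorm ℤ = rad a b c := by
    rw [conductorNorm_freyCurve_of_mod_holds A B hAB h0 hA hB, rad_def, ← hprod,
      ← Int.natAbs_natCast (radical (A * B * (A + B)).natAbs), Int.radical_natAbs_eq_radical]
  have hrad : rad a b c * 2 ^ k ≤ 2 * P * b := rad_mul_two_pow_le hP0 haP hcP hb0 h2kb
  have hqrad : q ∣ rad a b c := dvd_rad_of_prime_dvd hq hqb habc0
  refine ⟨A, B, hAB, h0, hA, hB, ?_, ?_, ⟨q, hq, by omega, hN ▸ hqrad⟩⟩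
  · -- `N₀ < q ≤ rad(abc) = N`
    rw [hN]
    have hradpos : 0 < rad a b c := by
      rw [rad_def]; exact Nat.pos_of_ne_zero radical_ne_zero
    exact lt_of_lt_of_le hN0q (Nat.le_of_dvd hradpos hqrad)
  · -- `2⁸ N⁶ ≤ (abc)²`
    rw [hN, hprod]
    have hba : b ≤ a := by omega
    have hbc : b ≤ c := by omega
    have hb3 : b ^ 3 ≤ a * b * c := by
      calc b ^ 3 = b * b * b := by ring
        _ ≤ a * b * c := by gcongr
    have h3 : (rad a b c * 2 ^ k) ^ 3 ≤ 8 * P ^ 3 * (a * b * c) := by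
      calc (rad a b c * 2 ^ k) ^ 3 ≤ (2 * P * b) ^ 3 := Nat.pow_le_pow_left hrad 3
        _ = 8 * P ^ 3 * b ^ 3 := by ring
        _ ≤ 8 * P ^ 3 * (a * b * c) := Nat.mul_le_mul_left _ hb3
    have h6 : (rad a b c * 2 ^ k) ^ 6 ≤ 64 * P ^ 6 * (a * b * c) ^ 2 := by
      calc (rad a b c * 2 ^ k) ^ 6 = ((rad a b c * 2 ^ k) ^ 3) ^ 2 := by ring
        _ ≤ (8 * P ^ 3 * (a * b * c)) ^ 2 := Nat.pow_le_pow_left h3 2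
        _ = 64 * P ^ 6 * (a * b * c) ^ 2 := by ring
    have hP6 : 2 ^ 14 * P ^ 6 ≤ 2 ^ (6 * k) := by
      have hP' : P ^ 6 ≤ (2 ^ q) ^ 6 := Nat.pow_le_pow_left hPG.le 6
      calc 2 ^ 14 * P ^ 6 ≤ 2 ^ 14 * (2 ^ q) ^ 6 := Nat.mul_le_mul_left _ hP'
        _ = 2 ^ (6 * q + 14) := by rw [← pow_mul, ← pow_add]; ring_nf
        _ ≤ 2 ^ (6 * k) := Nat.pow_le_pow_right two_pos (by omega)
    have hpk : 0 < 2 ^ (6 * k) := pow_pos two_pos _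
    refine Nat.le_of_mul_le_mul_right ?_ hpk
    have hpow : (2 : ℕ) ^ (6 * k) = (2 ^ k) ^ 6 := by rw [← pow_mul, Nat.mul_comm]
    calc 2 ^ 8 * rad a b c ^ 6 * 2 ^ (6 * k) = 2 ^ 8 * (rad a b c * 2 ^ k) ^ 6 := by
          rw [hpow]; ring
      _ ≤ 2 ^ 8 * (64 * P ^ 6 * (a * b * c) ^ 2) := Nat.mul_le_mul_left _ h6
      _ = 2 ^ 14 * P ^ 6 * (a * b * c) ^ 2 := by ring
      _ ≤ 2 ^ (6 * k) * (a * b * c) ^ 2 := Nat.mul_le_mul_right _ hP6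
      _ = (a * b * c) ^ 2 * 2 ^ (6 * k) := by ring

/-- Zagier + `c ≠ 0` + a Petersson lower bound + Silverman, run backwards on a datum of a GLOBALLY
MINIMAL integral model `W₀`: a degree bound `deg ≤ C₁ c² N^{2+δ}` forces
`|Δ(W₀)| ≤ max(A₀,1) · (4π² c₂/C₁ · N^{−(1+δ+η)})^{−(6+δ')}` (the minimal-model twin of
`FreyDegreeBound.Disproof.abs_Δ_le_of_frey_datum`, no `u`-scaling needed). [folklore] -/
theorem abs_Δ_le_of_minimal_datum
    (W₀ : WeierstrassCurve ℤ) (hmin : ∀ v : HeightOneSpectrum ℤ, (W₀.baseChange ℚ).IsMinimalAt v)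
    (hell : (W₀.baseChange ℚ).IsElliptic)
    {N : ℕ} [NeZero N] (D : ModularParametrizationData (W₀.baseChange ℚ) N)
    {C₁ c₂ A₀ δ δ' η : ℝ} (hC₁ : 0 < C₁) (hδ' : 0 < δ')
    (hdeg : (D.deg : ℝ) ≤ C₁ * (D.c : ℝ) ^ 2 * (N : ℝ) ^ (2 + δ))
    (hP : c₂ * (N : ℝ) ^ (1 - η) ≤ (peterssonProduct (Gamma0 N) 2 D.f D.f).re)
    (hc₂ : 0 < c₂)
    (hA₀ : ∀ (W : WeierstrassCurve ℚ) [W.IsElliptic] [W.IsGloballyMinimal] (L : PeriodPair),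
      IsNeronLatticeOf (W.baseChange ℂ) L →
        ((max |W.Δ| (|W.c₄| ^ 3) : ℚ) : ℝ) ≤ A₀ * ZLattice.covolume L.lattice ^ (-(6 + δ'))) :
    |(W₀.Δ : ℝ)| ≤
      max A₀ 1 * (4 * Real.pi ^ 2 * c₂ / C₁ * (N : ℝ) ^ (-(1 + δ + η))) ^ (-(6 + δ')) := by
  haveI := hell
  haveI : (W₀.baseChange ℚ).IsGloballyMinimal := isGloballyMinimal_of_forall_isMinimalAt_int _ hmin
  have hNr : (0 : ℝ) < N := by exact_mod_cast Nat.pos_of_ne_zero (NeZero.ne N)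
  have hc0 : D.maninConstant ≠ 0 := D.maninConstant_ne_zero_holds
  have hc : (D.c : ℝ) ≠ 0 := by exact_mod_cast hc0
  have hcov : 0 < ZLattice.covolume D.L.lattice := ZLattice.covolume_pos _ _
  have hZ := congrArg Complex.re D.zagier_degree_formula_holds
  rw [Complex.re_ofReal_mul, Complex.ofReal_re] at hZ
  have hlow := covolume_ge_of_zagier_exp hNr hC₁ hc hcov hZ hdeg hP
  have hSW := hA₀ (W₀.baseChange ℚ) D.L D.isNeronLattice
  have hΔq : (W₀.baseChange ℚ).Δ = (W₀.Δ : ℚ) := by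
    simp [WeierstrassCurve.baseChange, WeierstrassCurve.map_Δ]
  have h1 : |(W₀.Δ : ℝ)| ≤ max A₀ 1 * ZLattice.covolume D.L.lattice ^ (-(6 + δ')) := by
    have e1 : |(W₀.Δ : ℝ)| = ((|(W₀.baseChange ℚ).Δ| : ℚ) : ℝ) := by rw [hΔq]; push_cast; rfl
    have h0 : ((|(W₀.baseChange ℚ).Δ| : ℚ) : ℝ) ≤
        ((max |(W₀.baseChange ℚ).Δ| (|(W₀.baseChange ℚ).c₄| ^ 3) : ℚ) : ℝ) := by
      exact_mod_cast le_max_left _ _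
    have hpos : 0 ≤ ZLattice.covolume D.L.lattice ^ (-(6 + δ')) := Real.rpow_nonneg hcov.le _
    rw [e1]
    exact (h0.trans hSW).trans (mul_le_mul_of_nonneg_right (le_max_left A₀ 1) hpos)
  have hκ : 0 < 4 * Real.pi ^ 2 * c₂ / C₁ * (N : ℝ) ^ (-(1 + δ + η)) := by positivity
  have h2 : ZLattice.covolume D.L.lattice ^ (-(6 + δ')) ≤
      (4 * Real.pi ^ 2 * c₂ / C₁ * (N : ℝ) ^ (-(1 + δ + η))) ^ (-(6 + δ')) :=
    Real.rpow_le_rpow_of_nonpos hκ hlow (by linarith)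
  exact h1.trans (mul_le_mul_of_nonneg_left h2 (zero_le_one.trans (le_max_right _ _)))

/-- **Pointwise tightness on the global minimal models of Masser-type Frey curves.** Under a
Petersson lower bound `c₂ N^{1−η} ≤ (f,f)` for the newform of every datum, for `θ < 2 − η` and ANY
`C`: beyond some conductor `N₀`, EVERY modular parametrisation datum at level `N` of the global
minimal model `freyIntModel₂ A B ⊗ ℚ` (B–G (12.18)) of a Frey curve in Serre's normalisation with
Szpiro ratio `≥ 6` (`2⁸ N⁶ ≤ (AB(A+B))² = 2⁸|Δ_min|`) has `deg D > C · N^θ`. Same mechanism as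
`FreyDegreeBound.Disproof.deg_gt_on_szpiro_six_pairs` (Frey–Murty run backwards: Zagier, `c² ≥ 1`,
Petersson, Silverman with `δ' = 1 − e`, `e = θ − 1 + η < 1`, giving `N⁶ ≤ K N^{e(7−e)}`), on the
minimal model, whose conductor equals that of the Frey model (`conductorNorm_smul_rat`). [folklore] -/
theorem deg_gt_on_szpiro_six_minimal {η θ : ℝ} (hθ : θ < 2 - η)
    (hPη : ∃ c₂ : ℝ, 0 < c₂ ∧ ∀ (N : ℕ) [NeZero N] (W : WeierstrassCurve ℚ) [W.IsElliptic]
      (D : ModularParametrizationData W N),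
      c₂ * (N : ℝ) ^ (1 - η) ≤ (peterssonProduct (Gamma0 N) 2 D.f D.f).re) (C₀ : ℝ) :
    ∃ N₀ : ℕ, ∀ A B : ℤ, IsCoprime A B → A * B * (A + B) ≠ 0 → A ≡ -1 [ZMOD 4] → (32 : ℤ) ∣ B →
      N₀ < (freyCurve A B).conductorNorm ℤ →
      2 ^ 8 * ((freyCurve A B).conductorNorm ℤ) ^ 6 ≤ (A * B * (A + B)).natAbs ^ 2 →
      ∀ (N : ℕ) [NeZero N], (freyCurve A B).conductorNorm ℤ = N →
        ∀ D : ModularParametrizationData ((freyIntModel₂ A B).baseChange ℚ) N,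
          C₀ * (N : ℝ) ^ θ < D.deg := by
  obtain ⟨c₂, hc₂, hPc⟩ := hPη
  set e : ℝ := θ - 1 + η with hedef
  have he1 : e < 1 := by rw [hedef]; linarith
  set δ' : ℝ := 1 - e with hδ'def
  have hδ' : 0 < δ' := by rw [hδ'def]; linarith
  set g : ℝ := 6 - e * (6 + δ') with hgdef
  have hg : 0 < g := by
    have : g = (1 - e) * (6 - e) := by rw [hgdef, hδ'def]; ring
    rw [this]; exact mul_pos (by linarith) (by linarith)
  obtain ⟨A₀, hA₀⟩ := silverman1986_discriminant_c4_covolume_holds δ' hδ'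
  have hC₁ : (0 : ℝ) < max C₀ 1 := one_pos.trans_le (le_max_right _ _)
  set κ : ℝ := 4 * Real.pi ^ 2 * c₂ / max C₀ 1 with hκdef
  have hκ : 0 < κ := div_pos (by positivity) hC₁
  set K : ℝ := max A₀ 1 * κ ^ (-(6 + δ')) with hKdef
  have hK : 0 ≤ K := by positivity
  refine ⟨⌈K ^ (1 / g)⌉₊, fun A B hAB h0 hA hB hN₀ hexcess N _ hN D ↦ ?_⟩
  subst hN
  by_contra hD
  rw [not_lt] at hD
  have hA4 : 4 ∣ A + 1 := by
    have h := (Int.modEq_iff_dvd.mp hA)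
    have : A + 1 = -(-1 - A) := by ring
    rw [this]; exact (dvd_neg).mpr h
  have hB16 : (16 : ℤ) ∣ B := dvd_trans (by norm_num) hB
  have h4 : 4 ∣ B - A - 1 := by
    have : B - A - 1 = B - (A + 1) := by ring
    rw [this]; exact dvd_sub (dvd_trans (by norm_num) hB16) hA4
  have h16' : 16 ∣ A * B := dvd_mul_of_dvd_right hB16 _
  haveI := isElliptic_freyCurve h0
  haveI := isElliptic_freyIntModel₂ h0 h4 h16'
  set N : ℕ := (freyCurve A B).conductorNorm ℤ with hNdef
  have hN0 : 0 < N := conductorNorm_pos_holds (freyCurve A B)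
  have hNr : (0 : ℝ) < N := by exact_mod_cast hN0
  -- the degree bound in `c²`-form with exponent `2 + (θ − 2)`
  have hdeg : (D.deg : ℝ) ≤ max C₀ 1 * (D.c : ℝ) ^ 2 * (N : ℝ) ^ (2 + (θ - 2)) := by
    have hc1 : (1 : ℝ) ≤ (D.c : ℝ) ^ 2 := by
      have h1 : (1 : ℤ) ≤ D.c ^ 2 := by
        have h0' : D.c ≠ 0 := D.maninConstant_ne_zero_holds
        nlinarith [Int.one_le_abs h0', sq_abs D.c]
      exact_mod_cast h1
    have hN0' : (0 : ℝ) ≤ (N : ℝ) ^ θ := by positivity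
    rw [show 2 + (θ - 2) = θ by ring]
    calc (D.deg : ℝ) ≤ C₀ * (N : ℝ) ^ θ := hD
      _ ≤ max C₀ 1 * (N : ℝ) ^ θ := mul_le_mul_of_nonneg_right (le_max_left _ _) hN0'
      _ = max C₀ 1 * 1 * (N : ℝ) ^ θ := by ring
      _ ≤ max C₀ 1 * (D.c : ℝ) ^ 2 * (N : ℝ) ^ θ :=
          mul_le_mul_of_nonneg_right (mul_le_mul_of_nonneg_left hc1 hC₁.le) hN0'
  have hΔ := abs_Δ_le_of_minimal_datum (freyIntModel₂ A B) (isMinimalAt_freyIntModel₂ hAB hA4 hB16)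
    (isElliptic_freyIntModel₂ h0 h4 h16') D hC₁ hδ' hdeg (hPc N _ D) hc₂ hA₀
  -- `|Δ(W₀)| = (AB(A+B))² / 2⁸ ≥ N⁶`
  have hΔN : (N : ℝ) ^ (6 : ℕ) ≤ |((freyIntModel₂ A B).Δ : ℝ)| := by
    obtain ⟨w, hw⟩ := h16'
    have hw' : A * B / 16 = w := by rw [hw]; simp
    have hΔeq : (freyIntModel₂ A B).Δ = w ^ 2 * (A + B) ^ 2 := by
      rw [freyIntModel₂_Δ h4 ⟨w, hw⟩, hw']
    have hint : ((N : ℕ) : ℤ) ^ 6 ≤ w ^ 2 * (A + B) ^ 2 := by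
      have h' : ((2 ^ 8 * N ^ 6 : ℕ) : ℤ) ≤ ((A * B * (A + B)).natAbs ^ 2 : ℕ) := by
        exact_mod_cast hexcess
      push_cast at h'
      rw [sq_abs] at h'
      have h'' : (A * B * (A + B)) ^ 2 = 256 * (w ^ 2 * (A + B) ^ 2) := by rw [hw]; ring
      rw [h''] at h'
      linarith
    have hreal : (N : ℝ) ^ (6 : ℕ) ≤ ((w ^ 2 * (A + B) ^ 2 : ℤ) : ℝ) := by exact_mod_cast hint
    rw [hΔeq]
    exact hreal.trans (le_abs_self _)
  -- combine: `N⁶ ≤ K · N^{e(6+δ')}`, i.e. `N^g ≤ K`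
  have hcomb : (N : ℝ) ^ (6 : ℕ) ≤ K * (N : ℝ) ^ (e * (6 + δ')) := by
    have h := hΔN.trans hΔ
    have hexp : -(1 + (θ - 2) + η) * -(6 + δ') = e * (6 + δ') := by rw [hedef]; ring
    have hrew : (κ * (N : ℝ) ^ (-(1 + (θ - 2) + η))) ^ (-(6 + δ')) =
        κ ^ (-(6 + δ')) * (N : ℝ) ^ (e * (6 + δ')) := by
      rw [Real.mul_rpow hκ.le (Real.rpow_nonneg hNr.le _), ← Real.rpow_mul hNr.le, hexp]
    rw [hκdef] at hrew
    rw [hrew, ← mul_assoc] at h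
    exact h
  have hNg : (N : ℝ) ^ g ≤ K := by
    rw [hgdef, Real.rpow_sub hNr, Real.rpow_ofNat, div_le_iff₀ (Real.rpow_pos_of_pos hNr _)]
    exact hcomb
  have hNle : (N : ℝ) ≤ K ^ (1 / g) := by
    have h := Real.rpow_le_rpow (Real.rpow_nonneg hNr.le g) hNg (one_div_nonneg.mpr hg.le)
    rwa [← Real.rpow_mul hNr.le, mul_one_div_cancel hg.ne', Real.rpow_one] at h
  have hlt : (⌈K ^ (1 / g)⌉₊ : ℝ) < N := by exact_mod_cast hN₀
  exact absurd (hNle.trans (Nat.le_ceil _)) (not_le.mpr hlt)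

/-- **No exponent below `2 − η` in the consequent of crux B, under a Petersson lower bound
`(f,f) ≫ N^{1−η}`.** The global minimal models `freyIntModel₂ A B ⊗ ℚ` of the Masser-type Frey
pairs of `exists_masser_frey_pair` (= `FreyDegreeBound.Disproof.exists_frey_pair_excess`) (`N → ∞`, `N⁶ ≤ |Δ_min|`) are
semistable, globally minimal, with the conductor of the Frey model, so a bound `deg ≤ C N^θ` hands a
datum with `deg ≤ C N^θ` to `deg_gt_on_szpiro_six_minimal`. [folklore] -/
theorem not_polyDegreeExp_of_petersson {η θ : ℝ} (hθ : θ < 2 - η)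
    (hPη : ∃ c₂ : ℝ, 0 < c₂ ∧ ∀ (N : ℕ) [NeZero N] (W : WeierstrassCurve ℚ) [W.IsElliptic]
      (D : ModularParametrizationData W N),
      c₂ * (N : ℝ) ^ (1 - η) ≤ (peterssonProduct (Gamma0 N) 2 D.f D.f).re) :
    ¬ ∃ C : ℝ, ∀ (W : WeierstrassCurve ℚ) [W.IsElliptic] [W.IsGloballyMinimal]
      [NeZero (W.conductorNorm ℤ)], W.IsSemistable ℤ →
      ∃ D : ModularParametrizationData W (W.conductorNorm ℤ),
        (D.modularDegree : ℝ) ≤ C * (W.conductorNorm ℤ : ℝ) ^ θ := by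
  rintro ⟨C₀, hC₀⟩
  obtain ⟨N₀, hN₀⟩ := deg_gt_on_szpiro_six_minimal hθ hPη C₀
  obtain ⟨A, B, hAB, h0, hA, hB, hN, hexcess, -⟩ := exists_masser_frey_pair N₀
  have hA4 : 4 ∣ A + 1 := by
    have h := (Int.modEq_iff_dvd.mp hA)
    have : A + 1 = -(-1 - A) := by ring
    rw [this]; exact (dvd_neg).mpr h
  have hB16 : (16 : ℤ) ∣ B := dvd_trans (by norm_num) hB
  have h4 : 4 ∣ B - A - 1 := by
    have : B - A - 1 = B - (A + 1) := by ring
    rw [this]; exact dvd_sub (dvd_trans (by norm_num) hB16) hA4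
  have h16' : 16 ∣ A * B := dvd_mul_of_dvd_right hB16 _
  haveI := isElliptic_freyCurve h0
  haveI := isElliptic_freyIntModel₂ h0 h4 h16'
  haveI : ((freyIntModel₂ A B).baseChange ℚ).IsGloballyMinimal :=
    isGloballyMinimal_of_forall_isMinimalAt_int _ (isMinimalAt_freyIntModel₂ hAB hA4 hB16)
  have hCW := smul_freyCurve_eq_baseChange_freyIntModel₂ h4 h16'
  have hcond : ((freyIntModel₂ A B).baseChange ℚ).conductorNorm ℤ =
      (freyCurve A B).conductorNorm ℤ := by
    rw [← hCW, WeierstrassCurve.conductorNorm_smul_rat]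
  haveI : NeZero (((freyIntModel₂ A B).baseChange ℚ).conductorNorm ℤ) :=
    ⟨(conductorNorm_pos_holds _).ne'⟩
  have hss : ((freyIntModel₂ A B).baseChange ℚ).IsSemistable ℤ := by
    rw [← hCW]
    exact (WeierstrassCurve.isSemistable_smul_iff_holds ℤ (freyCurve A B) _).mpr
      (isSemistable_freyCurve_of_mod_holds A B hAB h0 hA hB)
  obtain ⟨D, hD⟩ := hC₀ ((freyIntModel₂ A B).baseChange ℚ) hss
  have hlt := hN₀ A B hAB h0 hA hB hN hexcess (((freyIntModel₂ A B).baseChange ℚ).conductorNorm ℤ)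
    hcond.symm D
  have hD' : (D.deg : ℝ) ≤ C₀ * ((((freyIntModel₂ A B).baseChange ℚ).conductorNorm ℤ : ℕ) : ℝ) ^ θ := hD
  exact absurd hD' (not_le.mpr hlt)

/-- **Unconditionally, the consequent of crux B fails for every exponent `θ < 3/2`** (tree
theorem `HoffsteinLockhart1994_peterssonProduct_lower_bound_of_half_lt`: `(f,f) ≫_η N^{1−η}` for
`η > 1/2`, with `η = 5/4 − θ/2`). So whatever exponent `κ` crux A is granted with, a proof of B
must output `κ' ≥ 3/2`. Sorry-free, standard axioms. [folklore] -/
theorem not_polyDegreeExp_of_lt_three_halves {θ : ℝ} (hθ : θ < 3 / 2) :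
    ¬ ∃ C : ℝ, ∀ (W : WeierstrassCurve ℚ) [W.IsElliptic] [W.IsGloballyMinimal]
      [NeZero (W.conductorNorm ℤ)], W.IsSemistable ℤ →
      ∃ D : ModularParametrizationData W (W.conductorNorm ℤ),
        (D.modularDegree : ℝ) ≤ C * (W.conductorNorm ℤ : ℝ) ^ θ := by
  have hη : 1 / 2 < 5 / 4 - θ / 2 := by linarith
  obtain ⟨c, hc, hP⟩ := HoffsteinLockhart1994_peterssonProduct_lower_bound_of_half_lt hη
  exact not_polyDegreeExp_of_petersson (by linarith) ⟨c, hc, hP⟩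

/-- **Under the route's own frame item `PeterssonLowerBound` (Hoffstein–Lockhart 1994), the
consequent of crux B fails for every exponent `θ < 2`:** Masser's "deg φ ≥ N^{2−o(1)} infinitely
often" on semistable minimal models. A proof of B inside this route must output `κ' ≥ 2`.
[folklore] -/
theorem not_polyDegreeExp_of_lt_two (hP : PeterssonLowerBound) {θ : ℝ} (hθ : θ < 2) :
    ¬ ∃ C : ℝ, ∀ (W : WeierstrassCurve ℚ) [W.IsElliptic] [W.IsGloballyMinimal]
      [NeZero (W.conductorNorm ℤ)], W.IsSemistable ℤ →
      ∃ D : ModularParametrizationData W (W.conductorNorm ℤ),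
        (D.modularDegree : ℝ) ≤ C * (W.conductorNorm ℤ : ℝ) ^ θ := by
  have hη : 0 < (2 - θ) / 2 := by linarith
  obtain ⟨c, hc, hcN⟩ := hP ((2 - θ) / 2) hη
  exact not_polyDegreeExp_of_petersson (by linarith)
    ⟨c, hc, fun N _ W _ D ↦ hcN N W D.f D.isNewformOf⟩


/-- Granted crux A (`DegreePrimesPolyBounded`, with ANY exponent), the fixed-exponent strengthening
`A → (∃ C, deg ≤ C·N^θ)` of crux B is FALSE for every `θ < 3/2`, unconditionally. [folklore] -/
theorem not_imp_polyDegreeExp_of_degreePrimes (hA : DegreePrimesPolyBounded) {θ : ℝ}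
    (hθ : θ < 3 / 2) :
    ¬ (DegreePrimesPolyBounded → ∃ C : ℝ, ∀ (W : WeierstrassCurve ℚ) [W.IsElliptic] [W.IsGloballyMinimal]
        [NeZero (W.conductorNorm ℤ)], W.IsSemistable ℤ →
        ∃ D : ModularParametrizationData W (W.conductorNorm ℤ),
          (D.modularDegree : ℝ) ≤ C * (W.conductorNorm ℤ : ℝ) ^ θ) :=
  fun h => not_polyDegreeExp_of_lt_three_halves hθ (h hA)

end Summit.ABC.ABC.Theorems.PolyDegreeOfBoundedPrimes.Negative

end
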